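import HarnessLib
import Summits.CriticalPhenomena.Ising3DConformalLimit.Theorems.HarmonicMomentsIsotropyTwoPointAsymptoticIsotropyPairPointwiseMonotone

/-!
# Vague asymptotic isotropy of the critical `ℤ³` two-point function, XVIII:
# CONTINUITY of the homogeneous kernel of a POINTWISE pair scaling limit (positive orthant)
(route HarmonicMomentsIsotropy, support item stmt-CriticalPhenomena-6036 `TwoPointAsymptoticIsotropy`;
fourth file of the pointwise line: item stmt-CriticalPhenomena-6153 `PointwiseLimit` ⇒ item 6036)

A pointwise limit of step functions need not be continuous; for the kernel `K(y) = S₂(0,y)` of a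
POINTWISE pair scaling limit of the critical `ℤ³` Ising two-point function, continuity on the closed
positive orthant minus the origin (`kernel_continuousOn_orthant_pt`) follows from homogeneity
`K(cy) = c^{-2Δ}K(y)` (automatic, file XV; a hypothesis here) and the Messager–Miracle-Solé monotonicity
of file XVII: a nearby `u` dominates `λu⁰` coordinatewise, so `K(u) ≤ λ^{-2Δ}K(u⁰)`; transferring the
small coordinates of `u` (those where `u⁰` vanishes) onto its largest coordinate produces a point
dominated by `λ⁻¹u⁰` (`exists_transfer_below_pt`), so `K(u) ≥ λ^{2Δ}K(u⁰)`. The extension to `ℝ³ ∖ {0}`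
by the sign symmetries (file XVI) and the upgrade to locally uniform convergence follow in file XIX.

References: A. Messager, S. Miracle-Solé, J. Stat. Phys. 17 (1977) 245–262 [MessagerMiracleSoleJSP1977].
No definitions are introduced.
-/

noncomputable section

namespace Summit.CriticalPhenomena.Ising3DConformalLimit.HarmonicMomentsIsotropyTwoPoint

open Literature.Probability.LatticeModels Literature.MathematicalPhysics.QuantumFieldTheory Filter Set
open scoped Topology
open Summit.CriticalPhenomena.Ising3DConformalLimit.HyperoctahedralRPTwoPoint
open Summit.CriticalPhenomena.Ising3DConformalLimit.RotationUpgradeFromTwoPointNegative (abs_apply_le_norm)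

variable {ρ : ℝ → ℝ} {S2 : (Fin 2 → EuclideanSpace ℝ (Fin 3)) → ℝ}

/-! ### Continuity on the closed positive orthant -/

/-- The scale `λ ∈ (0,1)` of the continuity argument: `λ^{-2Δ}M < M + ε` and `λ^{2Δ}M > M - ε`
(continuity of `c ↦ c^{-2Δ}M` at `c = 1`). [folklore] -/
theorem exists_scale_near_one {M ε : ℝ} (Δ : ℝ) (hε : 0 < ε) :
    ∃ lam : ℝ, 0 < lam ∧ lam < 1 ∧ lam ^ (-(2 * Δ)) * M < M + ε ∧ M - ε < lam⁻¹ ^ (-(2 * Δ)) * M := by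
  have hcont : ContinuousAt (fun c : ℝ => c ^ (-(2 * Δ)) * M) 1 :=
    (Real.continuousAt_rpow_const 1 (-(2 * Δ)) (Or.inl one_ne_zero)).mul continuousAt_const
  obtain ⟨θ, hθ, hθε⟩ := Metric.continuousAt_iff.1 hcont ε hε
  simp only [Real.one_rpow, one_mul] at hθε
  set θ' := min θ 1 / 4 with hθ'
  have hθ'pos : 0 < θ' := by positivity
  have hθ'le : θ' ≤ 1 / 4 := by
    have : min θ 1 ≤ 1 := min_le_right _ _
    rw [hθ']; linarith
  have hθ'θ : 4 * θ' ≤ θ := by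
    have : min θ 1 ≤ θ := min_le_left _ _
    rw [hθ']; linarith
  refine ⟨1 - θ', by linarith, by linarith, ?_, ?_⟩
  · have hd : dist (1 - θ') 1 < θ := by
      rw [Real.dist_eq, show (1:ℝ) - θ' - 1 = -θ' by ring, abs_neg, abs_of_pos hθ'pos]
      linarith
    have := hθε hd
    rw [Real.dist_eq] at this
    linarith [le_abs_self ((1 - θ') ^ (-(2 * Δ)) * M - M)]
  · have hlam0 : (0:ℝ) < 1 - θ' := by linarith
    have hd : dist (1 - θ')⁻¹ 1 < θ := by
      have h1 : (1 - θ')⁻¹ - 1 = θ' / (1 - θ') := by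
        field_simp
        ring
      have hpos : 0 < θ' / (1 - θ') := div_pos hθ'pos hlam0
      rw [Real.dist_eq, abs_of_pos (by linarith), h1, div_lt_iff₀ hlam0]
      nlinarith
    have := hθε hd
    rw [Real.dist_eq] at this
    linarith [neg_abs_le ((1 - θ')⁻¹ ^ (-(2 * Δ)) * M - M)]

/-- The two indices other than `i0 : Fin 3`. [folklore] -/
theorem exists_other_two (i0 : Fin 3) : ∃ j1 j2 : Fin 3, j1 ≠ i0 ∧ j2 ≠ i0 ∧ j1 ≠ j2 ∧
    ∀ l, l = i0 ∨ l = j1 ∨ l = j2 := by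
  fin_cases i0
  · exact ⟨1, 2, by decide, by decide, by decide, fun l => by fin_cases l <;> simp⟩
  · exact ⟨0, 2, by decide, by decide, by decide, fun l => by fin_cases l <;> simp⟩
  · exact ⟨0, 1, by decide, by decide, by decide, fun l => by fin_cases l <;> simp⟩

/-- **The lower-bound point.** For `u ≥ 0`, `u ≠ 0`, with largest coordinate `i0` and `r > 0`, there is
`w ≥ 0`, `w ≠ 0`, with `K(w) ≤ K(u)`, `w_{i0} ≤ u_{i0} + 4r` and `w_l = u_l - min(u_l, r)` for
`l ≠ i0` (two transfers `l → i0` of `min(u_l, r)` with slack `r`). [cite: MessagerMiracleSoleJSP1977, main theorem (monotonicity of ⟨σ₀σ_x⟩ under reflections)] -/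
theorem exists_transfer_below_pt
    (hlim : ∀ x ∈ NonCoincident 3 2, Tendsto (fun δ => rescaledCorrelator (criticalCorr 3) ρ 2 δ x)
      (𝓝[>] (0:ℝ)) (𝓝 (S2 x)))
    {u : EuclideanSpace ℝ (Fin 3)} (hu : ∀ l, 0 ≤ u l) (hu0 : u ≠ 0) {i0 : Fin 3}
    (hi0 : ∀ l, u l ≤ u i0) {r : ℝ} (hr : 0 < r) :
    ∃ w : EuclideanSpace ℝ (Fin 3), (∀ l, 0 ≤ w l) ∧ w ≠ 0 ∧ S2 ![0, w] ≤ S2 ![0, u] ∧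
      w i0 ≤ u i0 + 4 * r ∧ ∀ l, l ≠ i0 → w l = u l - min (u l) r := by
  obtain ⟨j1, j2, hj1, hj2, hj12, hcover⟩ := exists_other_two i0
  set a1 := min (u j1) r with ha1
  set a2 := min (u j2) r with ha2
  have ha1nn : 0 ≤ a1 := le_min (hu j1) hr.le
  have ha2nn : 0 ≤ a2 := le_min (hu j2) hr.le
  have ha1r : a1 ≤ r := min_le_right _ _
  have ha2r : a2 ≤ r := min_le_right _ _
  -- first transfer `j1 → i0`
  set w1 : EuclideanSpace ℝ (Fin 3) :=
    u + (a1 + r) • EuclideanSpace.single i0 (1:ℝ) - a1 • EuclideanSpace.single j1 (1:ℝ) with hw1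
  have hw1i0 : w1 i0 = u i0 + (a1 + r) := by simp [hw1, hj1]
  have hw1j1 : w1 j1 = u j1 - a1 := by simp [hw1, hj1.symm]
  have hw1j2 : w1 j2 = u j2 := by simp [hw1, hj2, hj12.symm]
  have hw1nn : ∀ l, 0 ≤ w1 l := fun l => by
    rcases hcover l with rfl | rfl | rfl
    · rw [hw1i0]; have := hu l; linarith
    · rw [hw1j1]; have := min_le_left (u l) r; linarith
    · rw [hw1j2]; exact hu l
  have hw10 : w1 ≠ 0 := by
    intro h
    have h1 := congrArg (fun w : EuclideanSpace ℝ (Fin 3) => w i0) h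
    simp only [hw1i0, PiLp.zero_apply] at h1
    have := hu i0
    linarith
  have hK1 : S2 ![0, w1] ≤ S2 ![0, u] :=
    kernel_absorb_le_pt hlim hu hu0 hj1.symm ha1nn (min_le_left _ _) (hi0 j1) hr
  -- second transfer `j2 → i0`
  set w2 : EuclideanSpace ℝ (Fin 3) :=
    w1 + (a2 + r) • EuclideanSpace.single i0 (1:ℝ) - a2 • EuclideanSpace.single j2 (1:ℝ) with hw2
  have hw2i0 : w2 i0 = w1 i0 + (a2 + r) := by simp [hw2, hj2]
  have hw2j2 : w2 j2 = w1 j2 - a2 := by simp [hw2, hj2.symm]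
  have hw2j1 : w2 j1 = w1 j1 := by simp [hw2, hj1, hj12]
  have hK2 : S2 ![0, w2] ≤ S2 ![0, w1] := by
    refine kernel_absorb_le_pt hlim hw1nn hw10 hj2.symm ha2nn ?_ ?_ hr
    · rw [hw1j2]; exact min_le_left _ _
    · rw [hw1j2, hw1i0]; have := hi0 j2; linarith
  have hw2nn : ∀ l, 0 ≤ w2 l := fun l => by
    rcases hcover l with rfl | rfl | rfl
    · rw [hw2i0]; have := hw1nn l; linarith
    · rw [hw2j1]; exact hw1nn _
    · rw [hw2j2, hw1j2]; have := min_le_left (u l) r; linarith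
  have hw20 : w2 ≠ 0 := by
    intro h
    have h1 := congrArg (fun w : EuclideanSpace ℝ (Fin 3) => w i0) h
    simp only [hw2i0, hw1i0, PiLp.zero_apply] at h1
    have := hu i0
    linarith
  refine ⟨w2, hw2nn, hw20, hK2.trans hK1, ?_, fun l hl => ?_⟩
  · rw [hw2i0, hw1i0]; linarith
  · rcases hcover l with rfl | rfl | rfl
    · exact absurd rfl hl
    · rw [hw2j1, hw1j1]
    · rw [hw2j2, hw1j2]

/-- **Continuity of a homogeneous pointwise kernel on the closed positive orthant minus the origin.**
If `K(y) = S₂(0,y)` is homogeneous of degree `-2Δ` off `0`, then `K` restricted to `{u ≥ 0, u ≠ 0}` is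
continuous (no positivity needed: the two-sided squeeze is multiplicative in `K(u⁰) ≥ 0`). [cite: MessagerMiracleSoleJSP1977, main theorem (monotonicity of ⟨σ₀σ_x⟩ under reflections)] -/
theorem kernel_continuousOn_orthant_pt
    (hlim : ∀ x ∈ NonCoincident 3 2, Tendsto (fun δ => rescaledCorrelator (criticalCorr 3) ρ 2 δ x)
      (𝓝[>] (0:ℝ)) (𝓝 (S2 x)))
    {Δ : ℝ} (hhom : ∀ c : ℝ, 0 < c → ∀ y : EuclideanSpace ℝ (Fin 3), y ≠ 0 →
      S2 ![0, c • y] = c ^ (-(2 * Δ)) * S2 ![0, y]) :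
    ContinuousOn (fun y : EuclideanSpace ℝ (Fin 3) => S2 ![0, y])
      {u | (∀ l, 0 ≤ u l) ∧ u ≠ 0} := by
  rw [Metric.continuousOn_iff]
  rintro u₀ ⟨hu₀, hu₀0⟩ ε hε
  set M := S2 ![0, u₀] with hM
  -- the largest coordinate `m > 0` and the smallest positive coordinate `μ > 0` of `u₀`
  obtain ⟨istar, -, histar⟩ := Finset.exists_max_image Finset.univ (fun l => u₀ l) Finset.univ_nonempty
  have hmmax : ∀ l, u₀ l ≤ u₀ istar := fun l => histar l (Finset.mem_univ l)
  have hmpos : 0 < u₀ istar := by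
    by_contra h
    apply hu₀0
    ext l
    have h1 := hmmax l
    have h2 := hu₀ l
    simp only [PiLp.zero_apply]
    linarith
  have hPne : (Finset.univ.filter fun l => 0 < u₀ l).Nonempty := ⟨istar, by simp [hmpos]⟩
  obtain ⟨imin, himin, hμmin⟩ := Finset.exists_min_image _ (fun l => u₀ l) hPne
  have hμpos : 0 < u₀ imin := by simpa using himin
  have hμle : ∀ l, 0 < u₀ l → u₀ imin ≤ u₀ l := fun l hl => hμmin l (by simp [hl])
  set m := u₀ istar with hm
  set μ := u₀ imin with hμ
  -- the scale `λ` and the radius `r`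
  obtain ⟨lam, hlam0, hlam1, hup, hdown⟩ := exists_scale_near_one (M := M) Δ hε
  set κ := lam⁻¹ - 1 with hκ
  have hκpos : 0 < κ := by rw [hκ]; linarith [one_lt_inv₀ hlam0 |>.2 hlam1]
  set r := min (m / 4) (min ((1 - lam) * μ) (κ * min μ (m / 10))) with hr
  have hrpos : 0 < r := by
    refine lt_min (by linarith) (lt_min (mul_pos (by linarith) hμpos) (mul_pos hκpos ?_))
    exact lt_min hμpos (by linarith)
  have hr1 : r ≤ m / 4 := min_le_left _ _
  have hr2 : r ≤ (1 - lam) * μ := (min_le_right _ _).trans (min_le_left _ _)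
  have hr3 : r ≤ κ * μ := ((min_le_right _ _).trans (min_le_right _ _)).trans
    (mul_le_mul_of_nonneg_left (min_le_left _ _) hκpos.le)
  have hr4 : r ≤ κ * (m / 10) := ((min_le_right _ _).trans (min_le_right _ _)).trans
    (mul_le_mul_of_nonneg_left (min_le_right _ _) hκpos.le)
  refine ⟨r, hrpos, ?_⟩
  rintro u ⟨hu, hu0⟩ hdist
  have hcoord : ∀ l, |u l - u₀ l| < r := fun l => by
    rw [dist_eq_norm] at hdist
    calc |u l - u₀ l| = |(u - u₀) l| := by simp
      _ ≤ ‖u - u₀‖ := abs_apply_le_norm _ _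
      _ < r := hdist
  -- UPPER bound: `lam • u₀ ≤ u`
  have hupper : S2 ![0, u] ≤ lam ^ (-(2 * Δ)) * M := by
    rw [← hhom lam hlam0 u₀ hu₀0]
    refine kernel_le_of_coord_le_pt hlim (p := lam • u₀) (fun l => ?_) (smul_ne_zero hlam0.ne' hu₀0)
      (fun l => ?_)
    · rw [PiLp.smul_apply, smul_eq_mul]; exact mul_nonneg hlam0.le (hu₀ l)
    · rw [PiLp.smul_apply, smul_eq_mul]
      have h1 := hcoord l
      rw [abs_lt] at h1
      rcases (hu₀ l).eq_or_lt with h0 | hpos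
      · rw [← h0, mul_zero]; exact hu l
      · have h2 : (1 - lam) * μ ≤ (1 - lam) * u₀ l :=
          mul_le_mul_of_nonneg_left (hμle l hpos) (by linarith)
        nlinarith [h1.1, h2, hr2]
  -- LOWER bound: transfer the small coordinates onto the largest coordinate `i0` of `u`
  obtain ⟨i0, -, hi0⟩ := Finset.exists_max_image Finset.univ (fun l => u l) Finset.univ_nonempty
  have hi0max : ∀ l, u l ≤ u i0 := fun l => hi0 l (Finset.mem_univ l)
  have hu₀i0 : m / 2 ≤ u₀ i0 := by
    have h1 := hcoord istar
    have h2 := hcoord i0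
    rw [abs_lt] at h1 h2
    have := hi0max istar
    linarith
  obtain ⟨w, hwnn, hw0, hKw, hwi0, hwl⟩ := exists_transfer_below_pt hlim hu hu0 hi0max hrpos
  have hwle : ∀ l, w l ≤ (lam⁻¹ • u₀) l := by
    intro l
    rw [PiLp.smul_apply, smul_eq_mul, show lam⁻¹ * u₀ l = u₀ l + κ * u₀ l by rw [hκ]; ring]
    have hcl := hcoord l
    rw [abs_lt] at hcl
    by_cases hl : l = i0
    · subst hl
      have h5 : κ * (m / 2) ≤ κ * u₀ l := mul_le_mul_of_nonneg_left hu₀i0 hκpos.le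
      linarith
    · rw [hwl l hl]
      rcases (hu₀ l).eq_or_lt with h0 | hpos
      · have hul : u l ≤ r := by rw [← h0] at hcl; linarith
        rw [min_eq_left hul, ← h0]; simp
      · have h3 : κ * μ ≤ κ * u₀ l := mul_le_mul_of_nonneg_left (hμle l hpos) hκpos.le
        have := min_le_right (u l) r
        have hmin0 : 0 ≤ min (u l) r := le_min (hu l) hrpos.le
        linarith
  have hlower : lam⁻¹ ^ (-(2 * Δ)) * M ≤ S2 ![0, u] := by
    rw [← hhom lam⁻¹ (by positivity) u₀ hu₀0]
    exact (kernel_le_of_coord_le_pt hlim hwnn hw0 hwle).trans hKw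
  rw [Real.dist_eq, abs_lt]
  constructor <;> linarith

end Summit.CriticalPhenomena.Ising3DConformalLimit.HarmonicMomentsIsotropyTwoPoint

end
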